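import Summits.QuantumFields.YangMills.Theorems.BalabanUVNodesN07SplitClauseLevelRaisingMarginWide
import Summits.QuantumFields.YangMills.Theorems.BalabanUVNodesN07LocalLettersCoreGuardedDatumB
import HarnessLib

/-!
# N07 [B11] (= [15] = [Balaban1985Variational]) Sect. F, S6 HEAD — MODULE 66′: LEVEL RAISING WITH A MARGIN OF ANY WIDTH, OVER A **BOND-LEVEL DETERMINING DATUM** AND A **TOP-DATA
# PREDICATE** — the `(bd, Dat)`-parametrised twins of MODULE 66 §3 (`datumGaugeSplitTopStepCoreG_of_marginClean_width ∕ …_of_marginCleanPrint`), concluding row S1c-0's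
# `DatumGaugeSplitTopStepCoreGB` (✓p766174); sub-row 66′ of the (E1)∕(iii-b) work plan (director-ym №338∕№339∕№341∕№343; FLAG №16; LOCATE-HSEAM 5d3298b8d191f169)

Cell `pub-ymgap`, width seat `pub-ymgap-dag-n07-w3` g15 («MINE 66′», bus 2026-08-30 08:05:23Z, on dag-n07-e g34's offer).  `--kind proof --supports stmt-QuantumFields-20541 --as helper`
(K0⁷; count-neutral; def-free).  PURELY ADDITIVE — «print-datum parametrisation of `…N07SplitClauseLevelRaisingMarginWide` §3 (FLAG №16 ∕ LOCATE-HSEAM 5d3298b8d191f169); the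
(b)-instances `datumGaugeSplitTopStepCoreG_of_marginClean_width ∕ …_of_marginCleanPrint` stay landed and true on their own text»; no displayed premise is deleted or weakened —
the data row and the two fibre rows become the PARAMETERS `(bd : BondDatum F) (Dat : TopData F N)` of F0c (`Node00/CriticalOnFibreTopGuardedB`, ✓p765717).
[15] = [Balaban1985Variational]; [6] = [Balaban1985RegularSpaces]; [II] = [Balaban1984PropagatorsII].

WHY.  MODULE 66 §3 reduces dag-n07-w4's guarded per-datum split token `DatumGaugeSplitTopStepCoreG` to its restriction to the width-`w` MARGIN-CLEAN meeting datums (print's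
«□ intersecting Ω_j but not Ω_{j+1}», (144) p. 300, with `□̃` of [6] p. 98 at `w = 2ρ`).  The reduction is the datum-free §2 `localGaugeSplitOn_allDatums_of_marginClean_width` applied
POINTWISE in `(W, U)` under the token's prefix — it merely THREADS the data row and the fibre rows.  So the same term proves the reduction for the `(bd, Dat)`-parametrised token of
row S1c-0 (`…N07LocalLettersCoreGuardedDatumB.DatumGaugeSplitTopStepCoreGB`), which is what the chart road's print-datum twins (dag-n07-e's `…TowerW152EB`, S1c) consume at
`bd := lamDatum F` ([II] (2.3)'s `Λ_j`, ruling (α)).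

WHAT IS PROVED (sorry-free; no definition; axioms standard): ★★★ `datumGaugeSplitTopStepCoreGB_of_marginClean_width` (any width `w` with the block tolerance `2w + 2ρ ≤ ρ·L + 1`),
★★★ `datumGaugeSplitTopStepCoreGB_of_marginCleanPrint` (`w = 2ρ`, tolerance automatic from `L > 11`) — MODULE 66 §3 verbatim but for the three rows; §1–§2 of MODULE 66 cited BY NAME.
HONEST FRAMING: count-neutral binder threading between displayed shapes; the clause itself (S3 + chart + budget) is discharged by nobody here; NOTHING of [15]'s analysis asserted; no
(b)-instance claimed false; K0⁷ stub 1 NOT closed; N05 ∕ N07 NOT discharged; counts unmoved (typed 28∕28 · discharged 8∕28); R4 = the conditional finite-𝕋⁴ rung `BalabanLadder.UV`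
ONLY; the YM mass gap (Clay) is NOT proved by any of this; nothing continuum ∕ ℝ⁴ ∕ OS.  No `sorry`, no `def`, no `instance`, no `notation`.

References: [15] p. 279 (class of cubes), (144) p. 300, (147)–(150) p. 301, (160) p. 303, (165)–(168) p. 304, Prop. 8 p. 304; [6] p. 98, (1.131) p. 99; [II] (2.3) p. 224.
-/

set_option autoImplicit false

noncomputable section
open scoped BigOperators Matrix.Norms.L2Operator

namespace Summit.QuantumFields.YangMills.BalabanUVNodes.N07SplitClauseLevelRaisingMarginWideB

open Literature.MathematicalPhysics.QuantumFieldTheory.Balaban1983to89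
open Literature.MathematicalPhysics.QuantumFieldTheory.Balaban1983to89.Node00
open Literature.MathematicalPhysics.QuantumFieldTheory.Balaban1983to89.B15DeterminingSets
open Literature.MathematicalPhysics.QuantumFieldTheory.Balaban1983to89.B15DeterminingSetsB
open T4Continuum (T4Family)
open B15Eq112TorusCover (cover)
open B14DomainGeom (Pt Within)
open B14.Eq213MaximalDomains (side cubeExt)
open B7Prop1Local (InBox)
open B8Eq131Cubes (box bLo bHi gs sqLo sqHi cube tcube)
open Summit.QuantumFields.YangMills.BalabanUVNodes.N07LocalLettersSplitCore (LocalGaugeSplitOn)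
open Summit.QuantumFields.YangMills.BalabanUVNodes.N07LocalLettersCoreGuardedB (DatumGaugeSplitTopStepCoreGB)
open Summit.QuantumFields.YangMills.BalabanUVNodes.N07SplitClauseLevelRaising (box_subset_box_succ_of_corner cubeExt_side_subset_box_cornerP)
open Summit.QuantumFields.YangMills.BalabanUVNodes.N07SplitClauseLevelRaisingMarginWide (localGaugeSplitOn_allDatums_of_marginClean_width
  exists_cornerP_wbox_subset_succ_of_width)

/-! ## §3′  The `(bd, Dat)`-parametrised token from its width-`w` margin-clean restriction; the PRINT corollary `w = 2ρ` -/

section ReductionB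

/-- ★★★ **THE GUARDED PER-DATUM TOKEN OVER `(bd, Dat)` FROM ITS WIDTH-`w` MARGIN-CLEAN RESTRICTION** (MODULE 66 §3 with the data row and the fibre rows
parametrised — print-datum parametrisation, FLAG №16 ∕ LOCATE-HSEAM 5d3298b8d191f169; the (b)-instance stays landed and true on its own text) — print's «□ intersecting Ω_j but NOT Ω_{j+1}» read with a margin of `w` level-`j` blocks for the
tree's grid datums: row S1c-0's `DatumGaugeSplitTopStepCoreGB F N Sup Mc ρ Adm bd Dat B₃ C θ Q κ a₀ a₁` holds as soon as the SAME clause is supplied under the SAME prefix at the datums whose print box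
comes within `3` of `Ω_j` (box form) AND is margin-clean at width `w`: `j = k ∨` «the widened box `box L (cornerP a − w) (sideP + 2w) j` carries no point of `Ω_{j+1}`».  Side letters
`1 ≤ Mc ≤ ρ`, the block tolerance `2w + 2ρ ≤ ρ·L + 1` (§1; in Bałaban's family every `w ≤ 5ρ`), `0 ≤ B₃ κ C θ Q`.
[cite: Balaban1985Variational, p.279 (class of cubes), (144) p.300, p.300 («□ intersecting Ω_j but not Ω_{j+1}»), (147)–(150) p.301, (160) p.303, (165)–(168) p.304, Prop. 8 p.304] -/
theorem datumGaugeSplitTopStepCoreGB_of_marginClean_width (F : T4Family) (N : ℕ) [NeZero N]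
    {Sup : (ν : Stage7Numerics) → (K : ℕ) → (ℕ → Set (Site (F.P K) 0)) → Set (Site (F.P K) 0)} {Mc ρ : ℕ} (hMc : 1 ≤ Mc) (hMcρ : Mc ≤ ρ)
    (w : ℕ) (hw : 2 * w + 2 * ρ ≤ ρ * F.L + 1)
    {Adm : StepGuard F} {bd : BondDatum F} {Dat : TopData F N} {B₃ C θ Q κ a₀ a₁ : ℝ} (hB₃ : 0 ≤ B₃) (hκ : 0 ≤ κ) (hC : 0 ≤ C) (hθ : 0 ≤ θ) (hQ : 0 ≤ Q)
    (h : ∀ (ν : Stage7Numerics) (M : ℕ) (g : ℕ → ℝ) (K k : ℕ) (s : SeqOfRecord F ν M g K k), Sect2.SeqSeparated ν.M₁ s → 0 < ν.M₁ → Adm ν M g K k s → 1 ≤ k →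
      ∀ (ε δ : ℕ → ℝ),
      (∀ n, n ≤ k → 0 < δ n ∧ δ n ≤ a₁) → (∀ n, n < k → δ n ≤ 2 * δ (n + 1)) → (∀ n, n < k → δ (n + 1) ≤ 2 * δ n) →
      (∀ n, n ≤ k → B₃ * δ n ≤ ε n ∧ ε n ≤ a₀) → (∀ n, n < k → ε n ≤ 2 * ε (n + 1)) → (∀ n, n < k → ε (n + 1) ≤ 2 * ε n) →
      ∀ W : MSField (F.P K) (SU N), Dat K s.Ω (Sup ν K s.Ω) k δ W →
        ∀ U : GaugeField (F.P K) 0 (SU N),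
          (∀ n, n ≤ k → PlaqSmallOn (Sect2.omegaPlaqsTop s.Ω (Sup ν K s.Ω) n) (ε n * (F.P K).eta n ^ 2) U) →
          (∀ n, n ≤ k → Sect2.CoDivSmallOn (Sect2.omegaBondsTop s.Ω (Sup ν K s.Ω) n) (ε n * (F.P K).eta n ^ 3) U) →
          AgreeOnB (bd K k s.Ω) (avgFamily (avOfRecord F N K) U) W →
          IsCritOnFibreB F N K (bd K k s.Ω) W U →
          ∀ j, 1 ≤ j → j ≤ k → ∀ a : Pt (F.P K).d,
            (∃ x ∈ box (F.P K).L (cornerP (F.P K) Mc ρ a) (sideP (F.P K) Mc ρ) j, ∃ y : Pt (F.P K).d, cover (F.P K) y ∈ s.Ω j ∧ Within ((3 : ℕ) : ℤ) x y) →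
            (j = k ∨ ∀ z ∈ box (F.P K).L (cornerP (F.P K) Mc ρ a - (w : Pt (F.P K).d)) (sideP (F.P K) Mc ρ + 2 * w) j, cover (F.P K) z ∉ s.Ω (j + 1)) →
            LocalGaugeSplitOn (cover (F.P K) '' box (F.P K).L (cornerP (F.P K) Mc ρ a) (sideP (F.P K) Mc ρ) j)
              ((F.P K).eta j) (κ * ε j) (C * δ j + θ * ε j + Q * ε j ^ 2) U) :
    DatumGaugeSplitTopStepCoreGB F N Sup Mc ρ Adm bd Dat B₃ C θ Q κ a₀ a₁ := by
  intro ν M g K k s hsep hM₁ hadm hk ε δ hδ hcompδ hcompδ' hε hεcomp hεcomp' W h7 U h17 h19 hfib hcrit j hj hjk a hmeet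
  have hL2 : 2 ≤ (F.P K).L := by have := F.hL11; rw [T4Family.P_L]; omega
  have hwK : 2 * w + 2 * ρ ≤ ρ * (F.P K).L + 1 := by rwa [T4Family.P_L]
  have hρ0 : 0 < ρ := lt_of_lt_of_le hMc hMcρ
  have hδ0 : ∀ n, n ≤ k → 0 ≤ δ n := fun n hn => (hδ n hn).1.le
  have hε0 : ∀ n, n ≤ k → 0 ≤ ε n := fun n hn => le_trans (mul_nonneg hB₃ (hδ0 n hn)) (hε n hn).1
  -- the token's meeting premise (grid cube within 3 of `Ω_j`) gives the box premise (`□ ⊆ 𝔔`)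
  have hmeet' : ∃ x ∈ box (F.P K).L (cornerP (F.P K) Mc ρ a) (sideP (F.P K) Mc ρ) j, ∃ y : Pt (F.P K).d,
      cover (F.P K) y ∈ s.Ω j ∧ Within ((3 : ℕ) : ℤ) x y := by
    obtain ⟨x, y, hx, hy, hw3⟩ := hmeet
    exact ⟨x, cubeExt_side_subset_box_cornerP Mc hρ0 a j hx, y, hy, hw3⟩
  exact localGaugeSplitOn_allDatums_of_marginClean_width hL2 w s.Ω k ε δ hκ hC hθ hQ hε0 hδ0 hεcomp' hcompδ' U
    (fun j' _ _ a' _ => exists_cornerP_wbox_subset_succ_of_width hMc hMcρ hwK a' j')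
    (h ν M g K k s hsep hM₁ hadm hk ε δ hδ hcompδ hcompδ' hε hεcomp hεcomp' W h7 U h17 h19 hfib hcrit) j hj hjk a hmeet'

/-- ★★★ **THE GUARDED PER-DATUM TOKEN OVER `(bd, Dat)` FROM ITS RESTRICTION TO PRINT's MARGIN-CLEAN DATUMS** (MODULE 66 §3, rows parametrised) (`w = 2ρ`: «□̃ misses Ω_{j+1}», Bałaban's (144) ∕ [6] p. 98 margin `2R₁M₁`; the block
tolerance `6ρ ≤ ρ·L + 1` is automatic from `L > 11`): the token holds as soon as the clause is supplied at the datums whose print box comes within `3` of `Ω_j` AND whose margin cube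
`box L (cornerP a − 2ρ) (sideP + 4ρ) j` (= `tcube`, §1) carries no point of `Ω_{j+1}` — a set of datums at which the chart's whole top box (print box + `ρ + 1` blocks, §1) misses `Ω_{j+1}`.
Side letters `1 ≤ Mc ≤ ρ`, `0 ≤ B₃ κ C θ Q` only. [cite: Balaban1985Variational, p.279 (class of cubes), (144) p.300, p.300 («□ intersecting Ω_j but not Ω_{j+1}»), (147)–(150) p.301, (160) p.303, (165)–(168) p.304, Prop. 8 p.304; Balaban1985RegularSpaces, p.98] -/
theorem datumGaugeSplitTopStepCoreGB_of_marginCleanPrint (F : T4Family) (N : ℕ) [NeZero N]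
    {Sup : (ν : Stage7Numerics) → (K : ℕ) → (ℕ → Set (Site (F.P K) 0)) → Set (Site (F.P K) 0)} {Mc ρ : ℕ} (hMc : 1 ≤ Mc) (hMcρ : Mc ≤ ρ)
    {Adm : StepGuard F} {bd : BondDatum F} {Dat : TopData F N} {B₃ C θ Q κ a₀ a₁ : ℝ} (hB₃ : 0 ≤ B₃) (hκ : 0 ≤ κ) (hC : 0 ≤ C) (hθ : 0 ≤ θ) (hQ : 0 ≤ Q)
    (h : ∀ (ν : Stage7Numerics) (M : ℕ) (g : ℕ → ℝ) (K k : ℕ) (s : SeqOfRecord F ν M g K k), Sect2.SeqSeparated ν.M₁ s → 0 < ν.M₁ → Adm ν M g K k s → 1 ≤ k →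
      ∀ (ε δ : ℕ → ℝ),
      (∀ n, n ≤ k → 0 < δ n ∧ δ n ≤ a₁) → (∀ n, n < k → δ n ≤ 2 * δ (n + 1)) → (∀ n, n < k → δ (n + 1) ≤ 2 * δ n) →
      (∀ n, n ≤ k → B₃ * δ n ≤ ε n ∧ ε n ≤ a₀) → (∀ n, n < k → ε n ≤ 2 * ε (n + 1)) → (∀ n, n < k → ε (n + 1) ≤ 2 * ε n) →
      ∀ W : MSField (F.P K) (SU N), Dat K s.Ω (Sup ν K s.Ω) k δ W →
        ∀ U : GaugeField (F.P K) 0 (SU N),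
          (∀ n, n ≤ k → PlaqSmallOn (Sect2.omegaPlaqsTop s.Ω (Sup ν K s.Ω) n) (ε n * (F.P K).eta n ^ 2) U) →
          (∀ n, n ≤ k → Sect2.CoDivSmallOn (Sect2.omegaBondsTop s.Ω (Sup ν K s.Ω) n) (ε n * (F.P K).eta n ^ 3) U) →
          AgreeOnB (bd K k s.Ω) (avgFamily (avOfRecord F N K) U) W →
          IsCritOnFibreB F N K (bd K k s.Ω) W U →
          ∀ j, 1 ≤ j → j ≤ k → ∀ a : Pt (F.P K).d,
            (∃ x ∈ box (F.P K).L (cornerP (F.P K) Mc ρ a) (sideP (F.P K) Mc ρ) j, ∃ y : Pt (F.P K).d, cover (F.P K) y ∈ s.Ω j ∧ Within ((3 : ℕ) : ℤ) x y) →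
            (j = k ∨ ∀ z ∈ box (F.P K).L (cornerP (F.P K) Mc ρ a - ((2 * ρ : ℕ) : Pt (F.P K).d)) (sideP (F.P K) Mc ρ + 2 * (2 * ρ)) j, cover (F.P K) z ∉ s.Ω (j + 1)) →
            LocalGaugeSplitOn (cover (F.P K) '' box (F.P K).L (cornerP (F.P K) Mc ρ a) (sideP (F.P K) Mc ρ) j)
              ((F.P K).eta j) (κ * ε j) (C * δ j + θ * ε j + Q * ε j ^ 2) U) :
    DatumGaugeSplitTopStepCoreGB F N Sup Mc ρ Adm bd Dat B₃ C θ Q κ a₀ a₁ :=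
  -- print's width `w = 2ρ`: `2·(2ρ) + 2ρ = 6ρ ≤ ρ·L + 1` since `L > 11`
  datumGaugeSplitTopStepCoreGB_of_marginClean_width F N hMc hMcρ (2 * ρ)
    (by have := F.hL11; nlinarith) hB₃ hκ hC hθ hQ h

end ReductionB

end Summit.QuantumFields.YangMills.BalabanUVNodes.N07SplitClauseLevelRaisingMarginWideB

end
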